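import Literature.NumberTheory.EllipticCurves.FormalGroupOmegaInvarianceProofs
import Literature.NumberTheory.EllipticCurves.CanonicalPAdicHeightThetaProofs
import Literature.AlgebraicGeometry.Resolution.MvPowerSeriesChainRule
import HarnessLib

/-!
# The sigma equation as a second logarithmic derivative, and the invariant derivation `D₁`
# on `σ(u +_F v)`, `σ(u -_F v)` (Blakestad–Grant 2023, proof of Prop. 14 — proofs only)

Trunk T-NT-EC (Literature/NumberTheory/EllipticCurves). Pure proof file on the way to the formal
Mazur–Tate theta relation (named fact `WeierstrassCurve.padicSigma_theta_formal`,
`CanonicalPAdicHeightThetaProofs.lean`). Two ingredients of Blakestad–Grant's proof of their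
Prop. 14:

* `X_sq_mul_logDeriv₂Num_of_satisfiesSigmaODE` — **the Mazur–Tate equation
  `x + c = -D(Dσ/σ)` as ratio data for `σ`**: if `σ = t + ⋯` (no constant term, linear coefficient
  `1`) satisfies the tree's pole-cleared `SatisfiesSigmaODE W σ c` (`PadicSigma.lean`), then
  `z² · (σ·D²σ - (Dσ)²) = -(X + cz²)·σ²` for `D = d/ω = formalInvariantDerivation`,
  `X = z²x = formalXMulSq` — i.e. `σ²·D(Dσ/σ) = -(x + c)σ²` (the two encodings agree);
* `formalInvariantDerivationMv_subst_formalGroupLaw` (+ `…Sub`, `…X_zero`, `…X_one`) —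
  **`D₁(h(u +_F v)) = (Dh)(u +_F v)`, `D₁(h(u -_F v)) = (Dh)(u -_F v)`**, `D₁(h(u)) = (Dh)(u)`,
  `D₁(h(v)) = 0` for the invariant derivation `D₁ = η(u)∂/∂u` (`formalInvariantDerivationMv 0`)
  on `R⟦u, v⟧` ("it follows that `D = d/ω` extends to the invariant derivation on `𝓕` … for any
  power series `h`, `D₁(h(t₁ +_𝓕 t₂)) = Dh(t)|_{t = t₁ +_𝓕 t₂}`", Blakestad–Grant §3, from
  `W(t₁ +_𝓕 t₂) d/dt₁(t₁ +_𝓕 t₂) = W(t₁)`, here `formalEta_subst_X_mul_pderiv_formalGroupLaw`);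
  hence the same for the second logarithmic derivative `logDeriv₂Num`
  (`logDeriv₂Num_formalInvariantDerivationMv_subst_…`);
* `sq_mul_logDeriv₂Num_sigma_subst_formalGroupLaw` (+ `…Sub`, `…X_zero`) — combining the two:
  **`F² · N₁(σ(F)) = -(X(F) + cF²)·σ(F)²`** for `F = u +_F v`, `F = u -_F v`, `F = u`
  ("`D₁(D₁σ(t₁ +_𝓕 t₂)/σ(t₁ +_𝓕 t₂)) = -x(t₁ +_𝓕 t₂) + β` … also with `t₂` replaced by `-t₂`").

## Sources

* C. Blakestad, D. Grant, *On the universal `p`-adic sigma and Weierstrass zeta functions*,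
  J. Number Theory 249 (2023) (arXiv:1903.02480), §3 p. 10 (the invariant derivation `D₁`,
  displayed formulas before Prop. 14; proof of Prop. 14, first display).
* B. Mazur, W. Stein, J. Tate, Doc. Math. Extra Vol. Coates (2006), Thm. 1.3 (the equation
  `x(t) + c = -(d/ω)((1/σ)(dσ/ω))`).
* B. Mazur, J. Tate, *The `p`-adic sigma function*, Duke Math. J. 62 (1991), Thm. 3.1.

## Design notes

Pure proof file: no definitions, no named facts. The sigma equation is consumed exactly in the
tree's encoding `SatisfiesSigmaODE` (with `s = σ/t`, `g = (s + ts')(ωs)⁻¹`); the bridge to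
`logDeriv₂Num` is `Dσ = g·s` (`g = tDσ/σ`). The `D₁`-lemmas need `[IsDomain R]` only through
`formalEta_subst_X_mul_pderiv_formalGroupLaw`.
-/

noncomputable section

open PowerSeries Literature.NumberTheory.EllipticCurves
open Literature.AlgebraicGeometry.Resolution (MvPowerSeries.pderiv MvPowerSeries.pderiv_X
  MvPowerSeries.pderiv_powerSeries_subst MvPowerSeries.pderiv_powerSeries_subst_X
  MvPowerSeries.pderiv_subst_pair)

namespace WeierstrassCurve

/-! ### The sigma equation as `z²·(σD²σ - (Dσ)²) = -(X + cz²)σ²` -/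

section ODE

variable {A : Type*} [CommRing A] [Algebra ℚ A] (V : WeierstrassCurve A)

variable {V} in
/-- **The Mazur–Tate sigma equation as a second logarithmic derivative, poles cleared.** If
`σ = t + ⋯` satisfies `x(t) + c = -(d/ω)((1/σ)(dσ/ω))` in the tree's encoding `SatisfiesSigmaODE`
(`ω·(t²x + ct²) = g - tg'`, `g = (s + ts')(ωs)⁻¹ = tDσ/σ`, `s = σ/t`), then for `D = d/ω`:
`σ·D(Dσ) - (Dσ)² = -(t²x + ct²)·s²`, and hence `t²·(σ·D(Dσ) - (Dσ)²) = -(t²x + ct²)·σ²`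
(`= -(x + c)σ²·t²`). [Mazur–Stein–Tate 2006, Thm. 1.3; Blakestad–Grant 2023, Thm. 1 and proof of
Prop. 14 (`D(Dσ/σ) = -x + β`)] [folklore] -/
theorem X_sq_mul_logDeriv₂Num_of_satisfiesSigmaODE {σ : A⟦X⟧} {c : A}
    (hσ0 : constantCoeff σ = 0) (hσ1 : coeff 1 σ = 1) (hODE : V.SatisfiesSigmaODE σ c) :
    X ^ 2 * logDeriv₂Num V.formalInvariantDerivation σ =
      -(V.formalXMulSq + C c * X ^ 2) * σ ^ 2 := by
  have h : V.formalOmega * (V.formalXMulSq + C c * X ^ 2) =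
      ((PowerSeries.mk fun n => coeff (n + 1) σ) + X * d⁄dX A (PowerSeries.mk fun n => coeff (n + 1) σ)) *
          PowerSeries.invOfUnit (V.formalOmega * PowerSeries.mk fun n => coeff (n + 1) σ) 1 -
        X * d⁄dX A (((PowerSeries.mk fun n => coeff (n + 1) σ) +
          X * d⁄dX A (PowerSeries.mk fun n => coeff (n + 1) σ)) *
          PowerSeries.invOfUnit (V.formalOmega * PowerSeries.mk fun n => coeff (n + 1) σ) 1) :=
    hODE
  set s : A⟦X⟧ := PowerSeries.mk fun n => coeff (n + 1) σ with hs
  set ui := PowerSeries.invOfUnit (V.formalOmega * s) 1 with hui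
  set g := (s + X * d⁄dX A s) * ui with hg
  -- `σ = t·s`, `s(0) = 1`
  have hσ : σ = X * s := by
    ext n
    cases n with
    | zero => rw [coeff_zero_X_mul, coeff_zero_eq_constantCoeff_apply, hσ0]
    | succ n => rw [coeff_succ_X_mul, hs, coeff_mk]
  have hs0 : constantCoeff s = 1 := by
    rw [← coeff_zero_eq_constantCoeff_apply, hs, coeff_mk]
    exact hσ1
  -- `ωη = 1`, `(ωs)·(ωs)⁻¹ = 1`
  have hωη : V.formalOmega * V.formalEta = 1 := V.formalOmega_mul_formalEta
  have hu : V.formalOmega * s * ui = 1 :=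
    PowerSeries.mul_invOfUnit (V.formalOmega * s) 1
      (by rw [map_mul, V.constantCoeff_formalOmega, hs0, mul_one, Units.val_one])
  -- `g·s = η(s + ts') = ησ' = Dσ`
  have hgs : g * s = V.formalEta * (s + X * d⁄dX A s) := by
    linear_combination s * hg + (-(s + X * d⁄dX A s) * ui * s) * hωη +
      ((s + X * d⁄dX A s) * V.formalEta) * hu
  have hDσ : V.formalInvariantDerivation σ = g * s := by
    rw [hgs, formalInvariantDerivation_apply, hσ, Derivation.leibniz, derivative_X, smul_eq_mul,
      smul_eq_mul]
    ring
  have hDDσ : V.formalInvariantDerivation (V.formalInvariantDerivation σ) =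
      V.formalEta * (g * d⁄dX A s + s * d⁄dX A g) := by
    rw [hDσ, formalInvariantDerivation_apply, Derivation.leibniz, smul_eq_mul, smul_eq_mul]
  -- the equation times `η`
  have hODEη : V.formalXMulSq + C c * X ^ 2 = V.formalEta * (g - X * d⁄dX A g) := by
    linear_combination (-(V.formalXMulSq + C c * X ^ 2)) * hωη + V.formalEta * h
  rw [logDeriv₂Num, hDDσ, hDσ, hODEη, hσ]
  linear_combination (-(X ^ 2 * g * s)) * hgs

end ODE

/-! ### `D₁` on `h(F)`, `h(u -_F v)`, `h(u)`, `h(v)` -/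

section Invariance

variable {R : Type*} [CommRing R] (W : WeierstrassCurve R)

/-- `(η·h').subst g = η(g)·h'(g)`: substitution is multiplicative (for `g` substitutable).
[folklore] -/
theorem formalInvariantDerivation_subst {g : MvPowerSeries (Fin 2) R} (hg : PowerSeries.HasSubst g)
    (h : R⟦X⟧) :
    (W.formalInvariantDerivation h).subst g = W.formalEta.subst g * (d⁄dX R h).subst g := by
  rw [formalInvariantDerivation_apply, PowerSeries.subst_mul hg]

/-- The substitution `(u, v) ↦ (u, i(v))` applied to `η(u)` gives `η(u)`. [folklore] -/
theorem subst_pair_formalNeg_formalEta_subst_X :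
    MvPowerSeries.subst ![MvPowerSeries.X 0,
        W.formalNeg.subst (MvPowerSeries.X 1 : MvPowerSeries (Fin 2) R)]
      (W.formalEta.subst (MvPowerSeries.X 0 : MvPowerSeries (Fin 2) R)) =
      W.formalEta.subst (MvPowerSeries.X 0 : MvPowerSeries (Fin 2) R) := by
  rw [mvSubst_powerSeries_subst (PowerSeries.HasSubst.X 0) W.hasSubst_pair_formalNeg,
    MvPowerSeries.subst_X W.hasSubst_pair_formalNeg]
  rfl

/-- `u -_F v` is substitutable. [folklore] -/
theorem hasSubst_formalGroupLawSub : PowerSeries.HasSubst W.formalGroupLawSub :=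
  PowerSeries.HasSubst.of_constantCoeff_zero W.constantCoeff_formalGroupLawSub

/-- `D₁(h(u)) = (Dh)(u)`: on functions of `u` alone `D₁` is `D`. [folklore] -/
theorem formalInvariantDerivationMv_subst_X_zero (h : R⟦X⟧) :
    W.formalInvariantDerivationMv 0 (h.subst (MvPowerSeries.X 0 : MvPowerSeries (Fin 2) R)) =
      (W.formalInvariantDerivation h).subst (MvPowerSeries.X 0 : MvPowerSeries (Fin 2) R) := by
  rw [formalInvariantDerivationMv_apply, MvPowerSeries.pderiv_powerSeries_subst_X, if_pos rfl,
    W.formalInvariantDerivation_subst (PowerSeries.HasSubst.X 0)]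

/-- `D₁(h(v)) = 0`: functions of `v` alone are `D₁`-constants. [folklore] -/
theorem formalInvariantDerivationMv_subst_X_one (h : R⟦X⟧) :
    W.formalInvariantDerivationMv 0 (h.subst (MvPowerSeries.X 1 : MvPowerSeries (Fin 2) R)) = 0 := by
  rw [formalInvariantDerivationMv_apply, MvPowerSeries.pderiv_powerSeries_subst_X, if_neg (by decide),
    mul_zero]

/-- `N_{D₁}(h(g)) = (N_D h)(g)` whenever `D₁` acts on functions of `g` as `D`. [folklore] -/
theorem logDeriv₂Num_subst_of_forall {g : MvPowerSeries (Fin 2) R} (hg : PowerSeries.HasSubst g)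
    (hD : ∀ h : R⟦X⟧, W.formalInvariantDerivationMv 0 (h.subst g) =
      (W.formalInvariantDerivation h).subst g) (h : R⟦X⟧) :
    logDeriv₂Num (W.formalInvariantDerivationMv 0) (h.subst g) =
      (logDeriv₂Num W.formalInvariantDerivation h).subst g := by
  rw [logDeriv₂Num, logDeriv₂Num, hD, hD, PowerSeries.subst_sub hg, PowerSeries.subst_mul hg,
    PowerSeries.subst_pow hg]

/-- `N_{D₁}(h(u)) = (N_D h)(u)`. [folklore] -/
theorem logDeriv₂Num_subst_X_zero (h : R⟦X⟧) :
    logDeriv₂Num (W.formalInvariantDerivationMv 0) (h.subst (MvPowerSeries.X 0 : MvPowerSeries (Fin 2) R)) =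
      (logDeriv₂Num W.formalInvariantDerivation h).subst (MvPowerSeries.X 0 : MvPowerSeries (Fin 2) R) :=
  W.logDeriv₂Num_subst_of_forall (PowerSeries.HasSubst.X 0) W.formalInvariantDerivationMv_subst_X_zero h

variable [IsDomain R]

/-- **`D₁(h(u +_F v)) = (Dh)(u +_F v)`**: the invariant derivation `D₁ = η(u)·∂/∂u` acts on
functions of `F(u, v)` as `D = d/ω` — chain rule plus the invariance
`η(u)·∂F/∂u = η(F)` of the differential. [Blakestad–Grant 2023, §3 ("for any power series
`h ∈ R⟦t⟧`, `D₁(h(t₁ +_𝓕 t₂)) = Dh(t)|_{t = t₁ +_𝓕 t₂}`"); Silverman AEC IV.4] [folklore] -/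
theorem formalInvariantDerivationMv_subst_formalGroupLaw (h : R⟦X⟧) :
    W.formalInvariantDerivationMv 0 (h.subst W.formalGroupLaw) =
      (W.formalInvariantDerivation h).subst W.formalGroupLaw := by
  rw [formalInvariantDerivationMv_apply,
    MvPowerSeries.pderiv_powerSeries_subst W.constantCoeff_formalGroupLaw,
    W.formalInvariantDerivation_subst W.hasSubst_formalGroupLaw,
    ← W.formalEta_subst_X_mul_pderiv_formalGroupLaw 0]
  ring

/-- **`η(u)·∂(u -_F v)/∂u = η(u -_F v)`**: the invariance of the differential for the
difference `F(u, i(v))` (substitute `v ↦ i(v)` in `η(u)∂F/∂u = η(F)`). [Blakestad–Grant 2023,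
§3; Silverman AEC IV.4] [folklore] -/
theorem formalEta_subst_X_mul_pderiv_formalGroupLawSub :
    W.formalEta.subst (MvPowerSeries.X 0 : MvPowerSeries (Fin 2) R) *
        MvPowerSeries.pderiv 0 W.formalGroupLawSub =
      W.formalEta.subst W.formalGroupLawSub := by
  have hs := W.hasSubst_pair_formalNeg
  have hpd : MvPowerSeries.pderiv 0 W.formalGroupLawSub =
      MvPowerSeries.subst ![MvPowerSeries.X 0,
        W.formalNeg.subst (MvPowerSeries.X 1 : MvPowerSeries (Fin 2) R)]
        (MvPowerSeries.pderiv 0 W.formalGroupLaw) := by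
    rw [formalGroupLawSub, MvPowerSeries.pderiv_subst_pair (MvPowerSeries.constantCoeff_X 0)
      (W.constantCoeff_formalNeg_subst_X 1), MvPowerSeries.pderiv_X, if_pos rfl, mul_one,
      MvPowerSeries.pderiv_powerSeries_subst_X, if_neg (by decide), mul_zero, add_zero]
  have h := congrArg (MvPowerSeries.subst ![MvPowerSeries.X 0,
    W.formalNeg.subst (MvPowerSeries.X 1 : MvPowerSeries (Fin 2) R)])
    (W.formalEta_subst_X_mul_pderiv_formalGroupLaw 0)
  rw [MvPowerSeries.subst_mul hs, W.subst_pair_formalNeg_formalEta_subst_X, ← hpd,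
    mvSubst_powerSeries_subst W.hasSubst_formalGroupLaw hs] at h
  exact h

/-- **`D₁(h(u -_F v)) = (Dh)(u -_F v)`** ("we also have `D₁(h(t₁ -_𝓕 t₂)) = Dh(t)|_{t = t₁ -_𝓕 t₂}`").
[Blakestad–Grant 2023, §3] [folklore] -/
theorem formalInvariantDerivationMv_subst_formalGroupLawSub (h : R⟦X⟧) :
    W.formalInvariantDerivationMv 0 (h.subst W.formalGroupLawSub) =
      (W.formalInvariantDerivation h).subst W.formalGroupLawSub := by
  rw [formalInvariantDerivationMv_apply,
    MvPowerSeries.pderiv_powerSeries_subst W.constantCoeff_formalGroupLawSub,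
    W.formalInvariantDerivation_subst W.hasSubst_formalGroupLawSub,
    ← W.formalEta_subst_X_mul_pderiv_formalGroupLawSub]
  ring

/-! ### The second logarithmic derivative under the substitutions `F`, `u -_F v` -/

/-- **`N_{D₁}(h(u +_F v)) = (N_D h)(u +_F v)`** for the second logarithmic derivative numerator
`N_δ(f) = f·δ²f - (δf)²`. [Blakestad–Grant 2023, proof of Prop. 14] [folklore] -/
theorem logDeriv₂Num_subst_formalGroupLaw (h : R⟦X⟧) :
    logDeriv₂Num (W.formalInvariantDerivationMv 0) (h.subst W.formalGroupLaw) =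
      (logDeriv₂Num W.formalInvariantDerivation h).subst W.formalGroupLaw :=
  W.logDeriv₂Num_subst_of_forall W.hasSubst_formalGroupLaw
    W.formalInvariantDerivationMv_subst_formalGroupLaw h

/-- **`N_{D₁}(h(u -_F v)) = (N_D h)(u -_F v)`.** [Blakestad–Grant 2023, proof of Prop. 14] [folklore] -/
theorem logDeriv₂Num_subst_formalGroupLawSub (h : R⟦X⟧) :
    logDeriv₂Num (W.formalInvariantDerivationMv 0) (h.subst W.formalGroupLawSub) =
      (logDeriv₂Num W.formalInvariantDerivation h).subst W.formalGroupLawSub :=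
  W.logDeriv₂Num_subst_of_forall W.hasSubst_formalGroupLawSub
    W.formalInvariantDerivationMv_subst_formalGroupLawSub h

end Invariance

/-! ### `F²·N₁(σ(F)) = -(X(F) + cF²)σ(F)²` for a solution of the sigma equation -/

section Sigma

variable {A : Type*} [CommRing A] [Algebra ℚ A] (V : WeierstrassCurve A)

variable {V} in
/-- Pushing the ratio data of `σ` through a substitution `g` on which `D₁` acts as `D`:
`g²·N₁(σ(g)) = -(X(g) + c g²)·σ(g)²`. [Blakestad–Grant 2023, proof of Prop. 14] [folklore] -/
theorem sq_mul_logDeriv₂Num_sigma_subst_of_forall {σ : A⟦X⟧} {c : A}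
    (hσ0 : constantCoeff σ = 0) (hσ1 : coeff 1 σ = 1) (hODE : V.SatisfiesSigmaODE σ c)
    {g : MvPowerSeries (Fin 2) A} (hg : PowerSeries.HasSubst g)
    (hD : ∀ h : A⟦X⟧, V.formalInvariantDerivationMv 0 (h.subst g) =
      (V.formalInvariantDerivation h).subst g) :
    g ^ 2 * logDeriv₂Num (V.formalInvariantDerivationMv 0) (σ.subst g) =
      -(V.formalXMulSq.subst g + MvPowerSeries.C c * g ^ 2) * σ.subst g ^ 2 := by
  have h := congrArg (PowerSeries.subst g) (X_sq_mul_logDeriv₂Num_of_satisfiesSigmaODE hσ0 hσ1 hODE)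
  have hneg : (-(V.formalXMulSq + C c * X ^ 2)).subst g =
      -(V.formalXMulSq.subst g + MvPowerSeries.C c * g ^ 2) := by
    rw [← PowerSeries.coe_substAlgHom hg, map_neg, map_add, map_mul, map_pow,
      PowerSeries.coe_substAlgHom hg, PowerSeries.subst_X hg, PowerSeries.subst_C]
  rw [PowerSeries.subst_mul hg, PowerSeries.subst_pow hg, PowerSeries.subst_X hg,
    PowerSeries.subst_mul hg, PowerSeries.subst_pow hg, hneg,
    ← V.logDeriv₂Num_subst_of_forall hg hD] at h
  exact h

variable [IsDomain A]

variable {V} in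
/-- **`F²·N₁(σ(u +_F v)) = -(X(u +_F v) + cF²)·σ(u +_F v)²`**: the sigma equation at `u +_F v`
through the invariant derivation ("`D₁(D₁σ(t₁ +_𝓕 t₂)/σ(t₁ +_𝓕 t₂)) = -x(t₁ +_𝓕 t₂) + β`").
[Blakestad–Grant 2023, proof of Prop. 14 (first display)] [folklore] -/
theorem sq_mul_logDeriv₂Num_sigma_subst_formalGroupLaw {σ : A⟦X⟧} {c : A}
    (hσ0 : constantCoeff σ = 0) (hσ1 : coeff 1 σ = 1) (hODE : V.SatisfiesSigmaODE σ c) :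
    V.formalGroupLaw ^ 2 * logDeriv₂Num (V.formalInvariantDerivationMv 0) (σ.subst V.formalGroupLaw) =
      -(V.formalXMulSq.subst V.formalGroupLaw + MvPowerSeries.C c * V.formalGroupLaw ^ 2) *
        σ.subst V.formalGroupLaw ^ 2 :=
  sq_mul_logDeriv₂Num_sigma_subst_of_forall hσ0 hσ1 hODE V.hasSubst_formalGroupLaw
    V.formalInvariantDerivationMv_subst_formalGroupLaw

variable {V} in
/-- **`(u -_F v)²·N₁(σ(u -_F v)) = -(X(u -_F v) + c(u -_F v)²)·σ(u -_F v)²`** ("applying this also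
with `t₂` replaced by `-t₂`"). [Blakestad–Grant 2023, proof of Prop. 14] [folklore] -/
theorem sq_mul_logDeriv₂Num_sigma_subst_formalGroupLawSub {σ : A⟦X⟧} {c : A}
    (hσ0 : constantCoeff σ = 0) (hσ1 : coeff 1 σ = 1) (hODE : V.SatisfiesSigmaODE σ c) :
    V.formalGroupLawSub ^ 2 *
        logDeriv₂Num (V.formalInvariantDerivationMv 0) (σ.subst V.formalGroupLawSub) =
      -(V.formalXMulSq.subst V.formalGroupLawSub + MvPowerSeries.C c * V.formalGroupLawSub ^ 2) *
        σ.subst V.formalGroupLawSub ^ 2 :=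
  sq_mul_logDeriv₂Num_sigma_subst_of_forall hσ0 hσ1 hODE V.hasSubst_formalGroupLawSub
    V.formalInvariantDerivationMv_subst_formalGroupLawSub

variable {V} in
omit [IsDomain A] in
/-- **`u²·N₁(σ(u)) = -(X(u) + cu²)·σ(u)²`**: the sigma equation read in the variable `u`.
[Mazur–Stein–Tate 2006, Thm. 1.3] [folklore] -/
theorem sq_mul_logDeriv₂Num_sigma_subst_X_zero {σ : A⟦X⟧} {c : A}
    (hσ0 : constantCoeff σ = 0) (hσ1 : coeff 1 σ = 1) (hODE : V.SatisfiesSigmaODE σ c) :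
    (MvPowerSeries.X 0 : MvPowerSeries (Fin 2) A) ^ 2 *
        logDeriv₂Num (V.formalInvariantDerivationMv 0)
          (σ.subst (MvPowerSeries.X 0 : MvPowerSeries (Fin 2) A)) =
      -(V.formalXMulSq.subst (MvPowerSeries.X 0 : MvPowerSeries (Fin 2) A) +
          MvPowerSeries.C c * (MvPowerSeries.X 0 : MvPowerSeries (Fin 2) A) ^ 2) *
        σ.subst (MvPowerSeries.X 0 : MvPowerSeries (Fin 2) A) ^ 2 :=
  sq_mul_logDeriv₂Num_sigma_subst_of_forall hσ0 hσ1 hODE (PowerSeries.HasSubst.X 0)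
    V.formalInvariantDerivationMv_subst_X_zero

end Sigma

end WeierstrassCurve
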